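/-
Copyright (c) 2026 the pub-hodgecm-mathlib formalisation cell (harness21).  Prover seat hodgecm-mathlib-K2E1-p06 (g2): Track B «K2-LIT»,
h413 = stmt-HodgeConjecture-24833, chair K2-lead (g0), dealer K2E1-plan (g0) POOL-A (2026-09-03T21:50:39Z); 2026-09-03.
-/
import Literature.NumberTheory.Automorphic.AdelicGroupDataGeometricSideCovol
import HarnessLib

/-!
# Crux `H413`, Track B road `K2_E1` «TraceFormulaBeta» — POOL-A `K2E1KernelDiagonalOrbitalUnfolding`: the geometric side on a compact
# automorphic quotient, unfolded class by class with the PRINTED covolumes, for the test function itself: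
# `∫_X Σ_{γ ∈ G(K)} Φ(x̃ γ x̃⁻¹) dμ(x) = c_μ · Σ_{[γ]} vol(G_γ(𝔸) ⧸ G_γ(K)) · ∫_{G(𝔸) ⧸ G_γ(𝔸)} Φ(y γ y⁻¹)`
(Gelbart (1975), (9.12)–(9.13) and Remark 9.23; Rogawski (1990), §14.5 pp. 237–238; Deitmar–Echterhoff (2014), Thm. 9.3.2)

Cell `hodgecm-mathlib`, crux item h413 = `stmt-HodgeConjecture-24833`, route `HCCMUnconditional`; squad K2, dealer K2E1-plan (g0) («POOL-A →
K2E1-p06 (g2)»: the GEOMETRIC SIDE in the compact-quotient regime, rows 14∕15 of the K2·E1 TABLE for an anisotropic `U(H)`).  THEOREMS ONLY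
(no `def`, no instance, no notation, no named fact, no `sorry`); lane `--supports stmt-HodgeConjecture-24833 --as helper` (count-neutral).

DEDUP («if ★ already has the kernel identity, cite it BY NAME»).  The tree HOLDS the compact-quotient geometric side: the kernel `K_Φ` of
`R(Φ)` (★ `cosetKernel` ∕ `quotientKernel`, `AutomorphicQuotientKernel*`), its diagonal `K_Φ(x̃, x̃) = κ Σ_{γ ∈ G(K)} Φ_A(x̃ γ x̃⁻¹)`
(★ `AdelicGroupData.quotientKernel_mk_mk_eq_smul_conjTsum`), the `[0, ∞]`-valued class-by-class unfolding with the printed covolumes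
(★ `AdelicGroupData.lintegral_conjTsum_eq_mul_tsum_covol_mul_of_center'_eq_bot` over ★ `Literature.MeasureTheory.Group.lintegral_conjTsum_eq_mul_tsum_covol_mul`)
and the `ℂ`-valued KERNEL-DIAGONAL form `∫_X K_Φ(x, x) dμ = κ Σ'_c d_c O_c(Φ)` (★ `AdelicGroupData.integral_quotientKernel_diag_eq_mul_tsum_covol_of_center'_eq_bot`,
★ `UnitaryGroup.integral_quotientKernel_diag_eq_mul_tsum_covol_cmDatum`; trace-functional form ★ `UnitaryGroupDiagTraceNormalized`).  NOT stated
there: the `ℂ`-valued identity FOR THE TEST FUNCTION ITSELF (no kernel, no Haar scalar `κ`) with the `μ`-integrability of the class sum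
`x ↦ Σ_γ Φ(x̃ γ x̃⁻¹)`; proved here by name from the ★ `[0, ∞]`-valued identity through the ★ Bochner transfer
`Literature.MeasureTheory.Group.integral_conjTsum_eq_tsum_of_lintegral_complex` and the ★ uniform majorant `AdelicGroupData.exists_conjTsum_enorm_le`:

* `exists_quotientKernel_diag_eq_mul_conjTsum_of_center'_eq_bot` — dictionary with the ★ kernel: `K_Φ(x̃, x̃) = κ · Σ'_γ Φ(x̃ γ x̃⁻¹)` with
  `κ = ρ({1}) > 0` (`ρ = κ · counting` on the discrete `G(K)`); so the identity below is ★'s kernel-diagonal identity divided by `κ`.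
* `integral_conjTsum_eq_tsum_covol_mul_of_center'_eq_bot` — for an ★ `AdelicGroupData` datum `𝒢` with `A_G = ⊥`, `G(K)` discrete and
  `X = G(𝔸_K) ⧸ G(K)` compact, automorphic `μ`, Haar measures `ν` on `G(𝔸_K)` and `ρ` on `G(K)`, and per conjugacy class `c` of `G(K)`
  (`γ_c = out c`, `G_c = C_{G(𝔸_K)}(γ_c)`, `G(K)_c = G(K) ∩ G_c`) a Haar measure `ν_c` on `G_c` and the restrictions `ρ_{H,c} = ρ|_{G(K)_c}`, `ρ_{F,c}`
  (★ `AdelicGroupData.exists_restricted_haar_of_center'_eq_bot`): for `Φ ∈ C_c(G(𝔸_K), ℂ)` the class sum (★ `conjTsum`) is `μ`-integrable, each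
  orbital integrand (★ `descConj`) is `ν ∕ ν_c`-integrable (`ν ∕ ν_c = quotientMeasure G_c ν_c ν`), the class series converges absolutely, and
    `∫_X Σ'_{γ ∈ G(K)} Φ(x̃ γ x̃⁻¹) dμ(x) = Σ'_c (c_μ · vol(G_c ⧸ G(K)_c)) · ∫_{G(𝔸_K) ⧸ G_c} Φ(y γ_c y⁻¹) d(ν ∕ ν_c)(y)`,
  `c_μ = unfoldingConstant G(K) ρ μ ν`, `vol(G_c ⧸ G(K)_c) = quotientMeasure (G(K)_c ⊓ G_c) ρ_{F,c} ν_c (univ)` — Gelbart's `meas(G(γ)_ℚ \ G(γ)_𝔸)`,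
  Rogawski's `a_γ`.  Tree convention: LEFT quotient `X = G(𝔸) ⧸ G(K)`, so print's `f(x⁻¹ γ x)` on `Γ \ G` reads `Φ(x̃ γ x̃⁻¹)`.
* `integral_conjTsum_eq_tsum_covol_mul_cmDatum` — the specialisation to the anisotropic unitary group `U(H)(𝔸_{L⁺})` of a CM field
  (★ `UnitaryGroup.cmDatum`: `A_G = ⊥`, `U(H)(L⁺)` discrete, compact quotient ★ `compactSpace_cmDatum_automorphicQuotient`).

HONEST LABEL.  Count-neutral by-name fold over ★; closes no socket of the K2·E1 TABLE; `HC_CM` is proved only modulo the 7 printed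
citations (2 remaining named inputs: hLiu418 = `stmt-HodgeConjecture-24832`, h413 = `stmt-HodgeConjecture-24833`) until rung 0 closes.

## References
* [Gelbart1975] S. Gelbart, *Automorphic forms on adele groups*, Ann. of Math. Stud. 83 (1975), (9.12)–(9.13) p. 117, Remark 9.23 p. 140.
* [Rogawski1990] J. D. Rogawski, *Automorphic Representations of Unitary Groups in Three Variables*, Ann. of Math. Stud. 123 (1990), §14.5
  pp. 237–238 (`J_{G′}(f′) = Σ_γ a_γ Φ(γ, f′)`, `a_γ = m(G′_γ \ G′_γ(𝔸))`).
* [DeitmarEchterhoff2014] A. Deitmar, S. Echterhoff, *Principles of Harmonic Analysis*, 2nd ed. (2014), Thm. 9.3.2, Lemma 9.3.3.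
-/

set_option autoImplicit false
set_option linter.dupNamespace false

noncomputable section

open MeasureTheory Measure Set Filter Topology NumberField CompactlySupported
open Literature.MeasureTheory.Group Literature.NumberTheory.Automorphic
open scoped ENNReal NNReal

universe u

namespace Summit.HodgeConjecture.HodgeConjecture.Cruxes.H413.K2E1KernelDiagonalOrbitalUnfolding

/-! ## §1 A datum with trivial split centre and compact quotient -/

section Generic

variable {K : Type} [Field K] [NumberField K] (𝒢 : AdelicGroupData.{u} K)

/-- For `A_G = ⊥` the trivial homomorphism is a continuous central retraction (values in `A_G`, the identity on `A_G`, trivial on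
`G(K)`) — the shape consumed by the ★ kernel files. [folklore] -/
private theorem centralRetraction_one (hc : 𝒢.center' = ⊥) :
    Continuous (1 : 𝒢.Adelic →* 𝒢.Adelic) ∧ (∀ g, (1 : 𝒢.Adelic →* 𝒢.Adelic) g ∈ 𝒢.center') ∧
      (∀ a ∈ 𝒢.center', (1 : 𝒢.Adelic →* 𝒢.Adelic) a = a) ∧
      ∀ γ ∈ 𝒢.arithmeticSubgroup, (1 : 𝒢.Adelic →* 𝒢.Adelic) γ = 1 := by
  refine ⟨continuous_const, fun g => ?_, fun a ha => ?_, fun γ _ => rfl⟩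
  · rw [MonoidHom.one_apply]
    exact one_mem _
  · rw [hc, Subgroup.mem_bot] at ha
    rw [ha, MonoidHom.one_apply]

attribute [local instance] AdelicGroupData.measurableSpaceQuotientForm AdelicGroupData.borelSpaceQuotientForm
  AdelicGroupData.smulInvariantMeasureQuotientForm AdelicGroupData.isFiniteMeasureOnCompactsQuotientForm
  AdelicGroupData.isFiniteMeasureQuotientForm

variable [LocallyCompactSpace 𝒢.Adelic] [SecondCountableTopology 𝒢.Adelic] [T2Space 𝒢.Adelic]
  [MeasurableSpace 𝒢.Adelic] [BorelSpace 𝒢.Adelic]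
  [∀ γ : 𝒢.Adelic, MeasurableSpace (𝒢.Adelic ⧸ Subgroup.centralizer ({γ} : Set 𝒢.Adelic))]
  [∀ γ : 𝒢.Adelic, BorelSpace (𝒢.Adelic ⧸ Subgroup.centralizer ({γ} : Set 𝒢.Adelic))]
  [∀ γ : 𝒢.Adelic, MeasurableSpace (↥(Subgroup.centralizer ({γ} : Set 𝒢.Adelic)) ⧸
    (𝒢.quotientSubgroup ⊓ Subgroup.centralizer ({γ} : Set 𝒢.Adelic)).subgroupOf
      (Subgroup.centralizer ({γ} : Set 𝒢.Adelic)))]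
  [∀ γ : 𝒢.Adelic, BorelSpace (↥(Subgroup.centralizer ({γ} : Set 𝒢.Adelic)) ⧸
    (𝒢.quotientSubgroup ⊓ Subgroup.centralizer ({γ} : Set 𝒢.Adelic)).subgroupOf
      (Subgroup.centralizer ({γ} : Set 𝒢.Adelic)))]

omit [∀ γ : 𝒢.Adelic, MeasurableSpace (𝒢.Adelic ⧸ Subgroup.centralizer ({γ} : Set 𝒢.Adelic))]
  [∀ γ : 𝒢.Adelic, BorelSpace (𝒢.Adelic ⧸ Subgroup.centralizer ({γ} : Set 𝒢.Adelic))]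
  [∀ γ : 𝒢.Adelic, MeasurableSpace (↥(Subgroup.centralizer ({γ} : Set 𝒢.Adelic)) ⧸
    (𝒢.quotientSubgroup ⊓ Subgroup.centralizer ({γ} : Set 𝒢.Adelic)).subgroupOf (Subgroup.centralizer ({γ} : Set 𝒢.Adelic)))]
  [∀ γ : 𝒢.Adelic, BorelSpace (↥(Subgroup.centralizer ({γ} : Set 𝒢.Adelic)) ⧸
    (𝒢.quotientSubgroup ⊓ Subgroup.centralizer ({γ} : Set 𝒢.Adelic)).subgroupOf (Subgroup.centralizer ({γ} : Set 𝒢.Adelic)))] in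
/-- **Dictionary with the ★ kernel: `K_Φ(x̃, x̃) = κ · Σ'_{γ ∈ G(K)} Φ(x̃ γ x̃⁻¹)` with `κ = ρ({1}) > 0`** the point mass of the Haar measure
`ρ` of the discrete `A_G · G(K) = G(K)` (`ρ = κ · counting`; Gelbart (1975), (9.12): `K(x, x) = Σ_{γ ∈ G_ℚ} f(x⁻¹ γ x)` for counting measure),
for `A_G = ⊥`, `G(K)` discrete, `A_G · G(K)` closed, `ρ` two-sided and s-finite (the binders of ★ `quotientKernel`): ★
`AdelicGroupData.quotientKernel_mk_mk_eq_smul_conjTsum` with the probability Haar measure on the trivial `A_G` (`Φ_A = Φ`) and the scalar of ★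
`AdelicGroupData.exists_eq_smul_map_mul_prod_count`, identified as `ρ({1})` by evaluating `ρ = κ · (δ ⊗ counting)` on `{1}`. [cite: Gelbart1975, (9.12) p. 117] -/
theorem exists_quotientKernel_diag_eq_mul_conjTsum_of_center'_eq_bot (hc : 𝒢.center' = ⊥)
    (hdisc : 𝒢.IsDiscreteRational) [hH : IsClosed (𝒢.quotientSubgroup : Set 𝒢.Adelic)]
    (ρ : Measure 𝒢.quotientSubgroup) [ρ.IsHaarMeasure] [ρ.IsMulRightInvariant] [SFinite ρ] :
    ∃ κ : ℝ≥0, 0 < κ ∧ ρ {1} = κ ∧ ∀ (Φ : C_c(𝒢.Adelic, ℂ)) (x₀ : 𝒢.Adelic), quotientKernel 𝒢.quotientSubgroup ρ Φ (QuotientGroup.mk x₀) (QuotientGroup.mk x₀) =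
        ((κ : ℝ) : ℂ) * conjTsum 𝒢.quotientSubgroup (𝒢.arithmeticSubgroup : Set 𝒢.Adelic)
          (AdelicGroupData.conj_mem_arithmeticSubgroup 𝒢) (⇑Φ) (QuotientGroup.mk x₀) := by
  classical
  haveI : DiscreteTopology 𝒢.arithmeticSubgroup := hdisc
  haveI : Countable 𝒢.arithmeticSubgroup := DiscreteSubgroup.countable_of_discrete _
  obtain ⟨hθc, hθA, hθa, hθγ⟩ := centralRetraction_one 𝒢 hc
  -- `A_G = 1`: a point; its probability Haar measure `α`, for which `Φ_A = Φ`
  have hsub : ∀ a : 𝒢.center', (a : 𝒢.Adelic) = 1 := fun a => Subgroup.mem_bot.1 (by rw [← hc]; exact a.2)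
  haveI : Subsingleton 𝒢.center' := ⟨fun a b => Subtype.ext ((hsub a).trans (hsub b).symm)⟩
  haveI : CompactSpace 𝒢.center' := Finite.compactSpace
  have hAc : IsClosed (𝒢.center' : Set 𝒢.Adelic) := by
    rw [hc, Subgroup.coe_bot]
    exact isClosed_singleton
  haveI : LocallyCompactSpace 𝒢.center' := hAc.isClosedEmbedding_subtypeVal.locallyCompactSpace
  obtain ⟨α, hαH, hα1⟩ : ∃ α : Measure 𝒢.center', α.IsHaarMeasure ∧ α Set.univ = 1 := by
    have h0 : (haar : Measure 𝒢.center') Set.univ ≠ 0 := (isOpen_univ.measure_pos haar ⟨1, trivial⟩).ne'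
    have htop : (haar : Measure 𝒢.center') Set.univ ≠ ∞ := (isCompact_univ.measure_lt_top (μ := (haar : Measure 𝒢.center'))).ne
    refine ⟨((haar : Measure 𝒢.center') Set.univ)⁻¹ • haar,
      IsHaarMeasure.smul (haar : Measure 𝒢.center') (ENNReal.inv_ne_zero.2 htop) (ENNReal.inv_ne_top.2 h0), ?_⟩
    rw [Measure.smul_apply, smul_eq_mul, ENNReal.inv_mul_cancel h0 htop]
  haveI := hαH
  haveI : IsFiniteMeasure α := ⟨by rw [hα1]; exact ENNReal.one_lt_top⟩
  -- `ρ = κ • (α ⊗ counting)`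
  obtain ⟨κ, hκpos, hκ⟩ := AdelicGroupData.exists_eq_smul_map_mul_prod_count 𝒢 hdisc 1 hθc hθA hθa hθγ α ρ
  refine ⟨κ, hκpos, ?_, fun Φ x₀ => ?_⟩
  · -- the mass of the point `1`: `κ · α(A_G) · #{1} = κ`
    have hme := AdelicGroupData.measurableEmbedding_mulMap 𝒢 1 hθc hθA hθa hθγ
    have hpre : (fun p : 𝒢.center' × 𝒢.arithmeticSubgroup =>
        (⟨(p.1 : 𝒢.Adelic) * p.2, AdelicGroupData.mulMap_mem 𝒢 p⟩ : 𝒢.quotientSubgroup)) ⁻¹' {1} =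
        (Set.univ : Set 𝒢.center') ×ˢ ({1} : Set 𝒢.arithmeticSubgroup) := by
      ext p
      simp only [Set.mem_preimage, Set.mem_singleton_iff, Set.mem_prod, Set.mem_univ, true_and]
      rw [Subtype.ext_iff, Subtype.ext_iff]
      change (p.1 : 𝒢.Adelic) * p.2 = 1 ↔ ((p.2 : 𝒢.Adelic)) = ((1 : 𝒢.arithmeticSubgroup) : 𝒢.Adelic)
      rw [hsub p.1, one_mul, OneMemClass.coe_one]
    rw [hκ, Measure.smul_apply, hme.map_apply, hpre, Measure.prod_prod, hα1, Measure.count_singleton, one_mul,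
      ENNReal.smul_def, smul_eq_mul, mul_one]
  · have hΦA : (fun g => ∫ a, Φ ((a : 𝒢.Adelic)⁻¹ * g) ∂α) = ⇑Φ := by
      funext g
      have h1 : (fun a : 𝒢.center' => Φ ((a : 𝒢.Adelic)⁻¹ * g)) = fun _ => Φ g := by
        funext a
        rw [hsub a, inv_one, one_mul]
      rw [h1, integral_const]
      simp [measureReal_def, hα1]
    rw [AdelicGroupData.quotientKernel_mk_mk_eq_smul_conjTsum 𝒢 hdisc 1 hθc hθA hθa hθγ α ρ hκ Φ x₀, hΦA,
      NNReal.smul_def, Complex.real_smul]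

/-- **The geometric side, class by class, with the printed covolumes, for the test function itself** (Gelbart (1975), (9.13):
`∫_{Γ\G} Σ_{γ ∈ Γ} φ(x⁻¹ γ x) dx = Σ_{[γ]} vol(Γ(γ) \ G_γ) ∫_{G_γ \ G} φ(x⁻¹ γ x) dx`; Remark 9.23; Deitmar–Echterhoff (2014), Thm. 9.3.2): for an ★ adelic
group datum `𝒢` with `A_G = ⊥`, `G(K)` discrete and `X = G(𝔸_K) ⧸ G(K)` compact, automorphic `μ`, Haar `ν` on `G(𝔸_K)` and `ρ` on `G(K)`, per-class
Haar measures `ν_c` on the adelic centralisers `G_c = C_{G(𝔸_K)}(γ_c)` (`γ_c = out c`) and restrictions `ρ_{H,c} = ρ|_{G(K) ∩ G_c}`, `ρ_{F,c}` (binders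
literally those of ★ `lintegral_conjTsum_eq_mul_tsum_covol_mul_of_center'_eq_bot`), and every `Φ ∈ C_c(G(𝔸_K), ℂ)`: the class sum is `μ`-integrable,
the orbital integrands are `ν ∕ ν_c`-integrable, the class series converges absolutely, and
  `∫_X Σ'_{γ ∈ G(K)} Φ(x̃ γ x̃⁻¹) dμ(x) = Σ'_c (c_μ · vol(G_c ⧸ G(K)_c)) · ∫_{G(𝔸_K) ⧸ G_c} Φ(y γ_c y⁻¹) d(ν ∕ ν_c)(y)`
(`c_μ = unfoldingConstant`, `ν ∕ ν_c = quotientMeasure G_c ν_c ν`, `vol = quotientMeasure (G(K)_c ⊓ G_c) ρ_{F,c} ν_c (univ)`; ★ `[0, ∞]` identity fed into ★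
`integral_conjTsum_eq_tsum_of_lintegral_complex`, finiteness by ★ `exists_conjTsum_enorm_le`). [cite: Gelbart1975, (9.13) and Remark 9.23]
[cite: DeitmarEchterhoff2014, Thm. 9.3.2] -/
theorem integral_conjTsum_eq_tsum_covol_mul_of_center'_eq_bot (hc : 𝒢.center' = ⊥)
    (hdisc : 𝒢.IsDiscreteRational) [CompactSpace 𝒢.automorphicQuotient]
    [hH : IsClosed (𝒢.quotientSubgroup : Set 𝒢.Adelic)]
    [hCcl : ∀ γ : 𝒢.Adelic, IsClosed ((Subgroup.centralizer ({γ} : Set 𝒢.Adelic) : Subgroup 𝒢.Adelic) : Set 𝒢.Adelic)]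
    (μ : Measure 𝒢.automorphicQuotient) [𝒢.IsAutomorphicMeasure μ]
    (ν : Measure 𝒢.Adelic) [IsHaarMeasure ν] [ν.IsMulRightInvariant]
    (ρ : Measure 𝒢.quotientSubgroup) [ρ.IsHaarMeasure] [SFinite ρ]
    (ρH : ∀ c : ConjClasses 𝒢.arithmeticSubgroup, Measure ↥(𝒢.quotientSubgroup ⊓
      Subgroup.centralizer ({((Quotient.out c : 𝒢.arithmeticSubgroup) : 𝒢.Adelic)} : Set 𝒢.Adelic)))
    [∀ c, IsHaarMeasure (ρH c)] [∀ c, (ρH c).IsInvInvariant] [∀ c, SFinite (ρH c)]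
    (ρF : ∀ c : ConjClasses 𝒢.arithmeticSubgroup, Measure ↥((𝒢.quotientSubgroup ⊓
      Subgroup.centralizer ({((Quotient.out c : 𝒢.arithmeticSubgroup) : 𝒢.Adelic)} : Set 𝒢.Adelic)).subgroupOf
        (Subgroup.centralizer ({((Quotient.out c : 𝒢.arithmeticSubgroup) : 𝒢.Adelic)} : Set 𝒢.Adelic))))
    [∀ c, IsHaarMeasure (ρF c)] [∀ c, (ρF c).IsInvInvariant] [∀ c, SFinite (ρF c)]
    (νC : ∀ c : ConjClasses 𝒢.arithmeticSubgroup, Measure ↥(Subgroup.centralizer ({((Quotient.out c : 𝒢.arithmeticSubgroup) : 𝒢.Adelic)} : Set 𝒢.Adelic)))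
    [∀ c, IsHaarMeasure (νC c)] [∀ c, (νC c).IsMulRightInvariant] [∀ c, (νC c).IsInvInvariant] [∀ c, SFinite (νC c)]
    (hρH : ∀ c, ρH c = ρ.comap (Subgroup.inclusion inf_le_left))
    (hρF : ∀ c, ρF c = Measure.map (Subgroup.subgroupOfEquivOfLe inf_le_right).symm (ρH c))
    (Φ : C_c(𝒢.Adelic, ℂ)) :
    Integrable (conjTsum 𝒢.quotientSubgroup (𝒢.arithmeticSubgroup : Set 𝒢.Adelic) (AdelicGroupData.conj_mem_arithmeticSubgroup 𝒢) (⇑Φ)) μ ∧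
    (∀ c : ConjClasses 𝒢.arithmeticSubgroup, Integrable (descConj ((Quotient.out c : 𝒢.arithmeticSubgroup) : 𝒢.Adelic)
        (Subgroup.centralizer ({((Quotient.out c : 𝒢.arithmeticSubgroup) : 𝒢.Adelic)} : Set 𝒢.Adelic))
        (fun _ hg => Subgroup.mem_centralizer_singleton_iff.1 hg) (⇑Φ)) (quotientMeasure (Subgroup.centralizer
          ({((Quotient.out c : 𝒢.arithmeticSubgroup) : 𝒢.Adelic)} : Set 𝒢.Adelic)) (νC c) (hCcl _) ν)) ∧
    Summable (fun c : ConjClasses 𝒢.arithmeticSubgroup => (unfoldingConstant 𝒢.quotientSubgroup ρ μ ν *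
        quotientMeasure ((𝒢.quotientSubgroup ⊓ Subgroup.centralizer ({((Quotient.out c : 𝒢.arithmeticSubgroup) : 𝒢.Adelic)} : Set 𝒢.Adelic)).subgroupOf
          (Subgroup.centralizer ({((Quotient.out c : 𝒢.arithmeticSubgroup) : 𝒢.Adelic)} : Set 𝒢.Adelic)))
          (ρF c) (isClosed_subgroupOf _ _ (hH.inter (hCcl _))) (νC c) Set.univ).toReal * ∫ y, ‖descConj ((Quotient.out c : 𝒢.arithmeticSubgroup) : 𝒢.Adelic)
        (Subgroup.centralizer ({((Quotient.out c : 𝒢.arithmeticSubgroup) : 𝒢.Adelic)} : Set 𝒢.Adelic))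
        (fun _ hg => Subgroup.mem_centralizer_singleton_iff.1 hg) (⇑Φ) y‖ ∂(quotientMeasure (Subgroup.centralizer
            ({((Quotient.out c : 𝒢.arithmeticSubgroup) : 𝒢.Adelic)} : Set 𝒢.Adelic)) (νC c) (hCcl _) ν)) ∧
    ∫ x, conjTsum 𝒢.quotientSubgroup (𝒢.arithmeticSubgroup : Set 𝒢.Adelic) (AdelicGroupData.conj_mem_arithmeticSubgroup 𝒢) (⇑Φ) x ∂μ =
      ∑' c : ConjClasses 𝒢.arithmeticSubgroup, (((unfoldingConstant 𝒢.quotientSubgroup ρ μ ν * quotientMeasure ((𝒢.quotientSubgroup ⊓ Subgroup.centralizer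
          ({((Quotient.out c : 𝒢.arithmeticSubgroup) : 𝒢.Adelic)} : Set 𝒢.Adelic)).subgroupOf
          (Subgroup.centralizer ({((Quotient.out c : 𝒢.arithmeticSubgroup) : 𝒢.Adelic)} : Set 𝒢.Adelic)))
          (ρF c) (isClosed_subgroupOf _ _ (hH.inter (hCcl _))) (νC c) Set.univ).toReal : ℝ) : ℂ) *
        ∫ y, descConj ((Quotient.out c : 𝒢.arithmeticSubgroup) : 𝒢.Adelic)
          (Subgroup.centralizer ({((Quotient.out c : 𝒢.arithmeticSubgroup) : 𝒢.Adelic)} : Set 𝒢.Adelic))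
          (fun _ hg => Subgroup.mem_centralizer_singleton_iff.1 hg) (⇑Φ) y ∂(quotientMeasure (Subgroup.centralizer
              ({((Quotient.out c : 𝒢.arithmeticSubgroup) : 𝒢.Adelic)} : Set 𝒢.Adelic)) (νC c) (hCcl _) ν) := by
  classical
  haveI : DiscreteTopology 𝒢.arithmeticSubgroup := hdisc
  haveI : Countable 𝒢.arithmeticSubgroup := DiscreteSubgroup.countable_of_discrete _
  obtain ⟨hθc, hθA, hθa, hθγ⟩ := centralRetraction_one 𝒢 hc
  -- the Haar measure of the discrete `A_G · G(K) = G(K)` is two-sided (needed by the ★ majorant)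
  haveI : ρ.IsMulRightInvariant := 𝒢.isMulRightInvariant_of_centralRetraction hdisc 1 hθc hθA hθa hθγ ρ
  have hρ0 : ρ ≠ 0 := fun h => by
    have h2 : 0 < ρ Set.univ := isOpen_univ.measure_pos ρ ⟨1, trivial⟩
    rw [h] at h2
    exact lt_irrefl _ h2
  -- `A_G = 1`: a point; its probability Haar measure `α`, for which `Φ_A = Φ`
  have hsub : ∀ a : 𝒢.center', (a : 𝒢.Adelic) = 1 := fun a =>
    Subgroup.mem_bot.1 (by rw [← hc]; exact a.2)
  haveI : Subsingleton 𝒢.center' := ⟨fun a b => Subtype.ext ((hsub a).trans (hsub b).symm)⟩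
  haveI : CompactSpace 𝒢.center' := Finite.compactSpace
  have hAc : IsClosed (𝒢.center' : Set 𝒢.Adelic) := by
    rw [hc, Subgroup.coe_bot]
    exact isClosed_singleton
  haveI : LocallyCompactSpace 𝒢.center' := hAc.isClosedEmbedding_subtypeVal.locallyCompactSpace
  obtain ⟨α, hαH, hα1⟩ : ∃ α : Measure 𝒢.center', α.IsHaarMeasure ∧ α Set.univ = 1 := by
    have h0 : (haar : Measure 𝒢.center') Set.univ ≠ 0 :=
      (isOpen_univ.measure_pos haar ⟨1, trivial⟩).ne'
    have htop : (haar : Measure 𝒢.center') Set.univ ≠ ∞ :=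
      (isCompact_univ.measure_lt_top (μ := (haar : Measure 𝒢.center'))).ne
    refine ⟨((haar : Measure 𝒢.center') Set.univ)⁻¹ • haar,
      IsHaarMeasure.smul (haar : Measure 𝒢.center') (ENNReal.inv_ne_zero.2 htop)
        (ENNReal.inv_ne_top.2 h0), ?_⟩
    rw [Measure.smul_apply, smul_eq_mul, ENNReal.inv_mul_cancel h0 htop]
  haveI := hαH
  haveI : IsFiniteMeasure α := ⟨by rw [hα1]; exact ENNReal.one_lt_top⟩
  have hΦA : (fun g => ∫ a, Φ ((a : 𝒢.Adelic)⁻¹ * g) ∂α) = ⇑Φ := by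
    funext g
    have h1 : (fun a : 𝒢.center' => Φ ((a : 𝒢.Adelic)⁻¹ * g)) = fun _ => Φ g := by
      funext a
      rw [hsub a, inv_one, one_mul]
    rw [h1, integral_const]
    simp [measureReal_def, hα1]
  -- `ρ = κ • (α ⊗ counting)`
  obtain ⟨κ, -, hκ⟩ := AdelicGroupData.exists_eq_smul_map_mul_prod_count 𝒢 hdisc 1 hθc hθA hθa hθγ α ρ
  -- per-class compactness of `G_c ⧸ G(K)_c` (discrete cocompact `G(K)`)
  haveI : ∀ c : ConjClasses 𝒢.arithmeticSubgroup,
      CompactSpace (↥(Subgroup.centralizer ({((Quotient.out c : 𝒢.arithmeticSubgroup) : 𝒢.Adelic)} : Set 𝒢.Adelic)) ⧸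
        (𝒢.quotientSubgroup ⊓ Subgroup.centralizer ({((Quotient.out c : 𝒢.arithmeticSubgroup) : 𝒢.Adelic)} :
          Set 𝒢.Adelic)).subgroupOf (Subgroup.centralizer
            ({((Quotient.out c : 𝒢.arithmeticSubgroup) : 𝒢.Adelic)} : Set 𝒢.Adelic))) :=
    fun c => 𝒢.compactSpace_centralizer_quotient hdisc (Quotient.out c).2
  -- the explicit constants `d_c = c_μ · vol_c` are non-zero (indeed in `(0, ∞)`)
  have hcμ : (unfoldingConstant 𝒢.quotientSubgroup ρ μ ν : ℝ≥0∞) ≠ 0 :=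
    ENNReal.coe_ne_zero.2 (unfoldingConstant_pos 𝒢.quotientSubgroup ρ μ ν
      (AdelicGroupData.IsAutomorphicMeasure.ne_zero 𝒢 μ) hρ0).ne'
  have hd0 : ∀ c : ConjClasses 𝒢.arithmeticSubgroup,
      unfoldingConstant 𝒢.quotientSubgroup ρ μ ν *
          quotientMeasure ((𝒢.quotientSubgroup ⊓ Subgroup.centralizer
            ({((Quotient.out c : 𝒢.arithmeticSubgroup) : 𝒢.Adelic)} : Set 𝒢.Adelic)).subgroupOf
            (Subgroup.centralizer ({((Quotient.out c : 𝒢.arithmeticSubgroup) : 𝒢.Adelic)} : Set 𝒢.Adelic)))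
            (ρF c) (isClosed_subgroupOf _ _ (hH.inter (hCcl _))) (νC c) Set.univ ≠ 0 := fun c =>
    mul_ne_zero hcμ (Measure.measure_univ_ne_zero.2 (quotientMeasure_ne_zero
      (((𝒢.quotientSubgroup ⊓ Subgroup.centralizer
        ({((Quotient.out c : 𝒢.arithmeticSubgroup) : 𝒢.Adelic)} : Set 𝒢.Adelic)).subgroupOf
        (Subgroup.centralizer ({((Quotient.out c : 𝒢.arithmeticSubgroup) : 𝒢.Adelic)} : Set 𝒢.Adelic))))
      (ρF c) (isClosed_subgroupOf _ _ (hH.inter (hCcl _))) (νC c)))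
  -- the ★ `[0, ∞]`-valued identity with the printed covolumes, constants regrouped as `d_c · ∫⁻`
  have hId : ∀ F : 𝒢.Adelic → ℝ≥0∞, Measurable F →
      ∫⁻ x, conjTsum 𝒢.quotientSubgroup (𝒢.arithmeticSubgroup : Set 𝒢.Adelic)
          (AdelicGroupData.conj_mem_arithmeticSubgroup 𝒢) F x ∂μ =
        ∑' c : ConjClasses 𝒢.arithmeticSubgroup, (unfoldingConstant 𝒢.quotientSubgroup ρ μ ν *
          quotientMeasure ((𝒢.quotientSubgroup ⊓ Subgroup.centralizer
            ({((Quotient.out c : 𝒢.arithmeticSubgroup) : 𝒢.Adelic)} : Set 𝒢.Adelic)).subgroupOf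
            (Subgroup.centralizer ({((Quotient.out c : 𝒢.arithmeticSubgroup) : 𝒢.Adelic)} : Set 𝒢.Adelic)))
            (ρF c) (isClosed_subgroupOf _ _ (hH.inter (hCcl _))) (νC c) Set.univ) *
          ∫⁻ y, descConj ((Quotient.out c : 𝒢.arithmeticSubgroup) : 𝒢.Adelic)
            (Subgroup.centralizer ({((Quotient.out c : 𝒢.arithmeticSubgroup) : 𝒢.Adelic)} : Set 𝒢.Adelic))
            (fun _ hg => Subgroup.mem_centralizer_singleton_iff.1 hg) F y
            ∂quotientMeasure (Subgroup.centralizer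
              ({((Quotient.out c : 𝒢.arithmeticSubgroup) : 𝒢.Adelic)} : Set 𝒢.Adelic)) (νC c) (hCcl _) ν := by
    intro F hF
    rw [𝒢.lintegral_conjTsum_eq_mul_tsum_covol_mul_of_center'_eq_bot hc hdisc μ ν ρ ρH ρF νC hρH hρF hF,
      ← ENNReal.tsum_mul_left]
    exact tsum_congr fun c => by rw [mul_assoc]
  -- finiteness of `∫_X Σ_γ |Φ(x̃ γ x̃⁻¹)| dμ` on the compact quotient (★ uniform majorant)
  obtain ⟨C, hCt, hC⟩ := AdelicGroupData.exists_conjTsum_enorm_le 𝒢 1 hθc hθA hθa hθγ α ρ hκ hρ0 Φ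
  have hΦAe : (fun g => ‖∫ a, Φ ((a : 𝒢.Adelic)⁻¹ * g) ∂α‖ₑ) = fun g => ‖Φ g‖ₑ := by
    funext g
    rw [show (∫ a, Φ ((a : 𝒢.Adelic)⁻¹ * g) ∂α) = Φ g from congrFun hΦA g]
  rw [hΦAe] at hC
  have hfin : ∫⁻ x, conjTsum 𝒢.quotientSubgroup (𝒢.arithmeticSubgroup : Set 𝒢.Adelic)
      (AdelicGroupData.conj_mem_arithmeticSubgroup 𝒢) (fun g => ‖Φ g‖ₑ) x ∂μ < ∞ := by
    calc ∫⁻ x, conjTsum 𝒢.quotientSubgroup (𝒢.arithmeticSubgroup : Set 𝒢.Adelic)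
          (AdelicGroupData.conj_mem_arithmeticSubgroup 𝒢) (fun g => ‖Φ g‖ₑ) x ∂μ
        ≤ ∫⁻ _, C ∂μ := lintegral_mono fun x => hC x
      _ = C * μ Set.univ := lintegral_const C
      _ < ∞ := ENNReal.mul_lt_top hCt.lt_top (measure_lt_top μ _)
  exact integral_conjTsum_eq_tsum_of_lintegral_complex 𝒢.quotientSubgroup
    (𝒢.arithmeticSubgroup : Set 𝒢.Adelic) (AdelicGroupData.conj_mem_arithmeticSubgroup 𝒢) μ
    (fun c : ConjClasses 𝒢.arithmeticSubgroup => ((Quotient.out c : 𝒢.arithmeticSubgroup) : 𝒢.Adelic))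
    (fun c => Subgroup.centralizer ({((Quotient.out c : 𝒢.arithmeticSubgroup) : 𝒢.Adelic)} : Set 𝒢.Adelic))
    (fun c => fun _ hg => Subgroup.mem_centralizer_singleton_iff.1 hg)
    (fun c => quotientMeasure (Subgroup.centralizer
      ({((Quotient.out c : 𝒢.arithmeticSubgroup) : 𝒢.Adelic)} : Set 𝒢.Adelic)) (νC c) (hCcl _) ν)
    hd0 hId Φ.continuous.measurable hfin

end Generic

/-! ## §2 The anisotropic unitary group `U(H)(𝔸_{L⁺})` of a CM field -/

section Unitary

open Literature.AlgebraicGeometry.ShimuraVarieties (hermForm)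
open UnitaryGroup

variable (L : Type) [Field L] [NumberField L] [IsCMField L] (N : ℕ) (H : Matrix (Fin N) (Fin N) L)
  [MeasurableSpace (cmDatum L N H).Adelic] [BorelSpace (cmDatum L N H).Adelic]
  [∀ γ : (cmDatum L N H).Adelic, MeasurableSpace ((cmDatum L N H).Adelic ⧸
    Subgroup.centralizer ({γ} : Set (cmDatum L N H).Adelic))]
  [∀ γ : (cmDatum L N H).Adelic, BorelSpace ((cmDatum L N H).Adelic ⧸
    Subgroup.centralizer ({γ} : Set (cmDatum L N H).Adelic))]
  [∀ γ : (cmDatum L N H).Adelic, MeasurableSpace (↥(Subgroup.centralizer ({γ} : Set (cmDatum L N H).Adelic)) ⧸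
    ((cmDatum L N H).quotientSubgroup ⊓ Subgroup.centralizer ({γ} : Set (cmDatum L N H).Adelic)).subgroupOf
      (Subgroup.centralizer ({γ} : Set (cmDatum L N H).Adelic)))]
  [∀ γ : (cmDatum L N H).Adelic, BorelSpace (↥(Subgroup.centralizer ({γ} : Set (cmDatum L N H).Adelic)) ⧸
    ((cmDatum L N H).quotientSubgroup ⊓ Subgroup.centralizer ({γ} : Set (cmDatum L N H).Adelic)).subgroupOf
      (Subgroup.centralizer ({γ} : Set (cmDatum L N H).Adelic)))]

attribute [local instance] AdelicGroupData.measurableSpaceQuotientForm AdelicGroupData.borelSpaceQuotientForm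
  AdelicGroupData.smulInvariantMeasureQuotientForm AdelicGroupData.isFiniteMeasureOnCompactsQuotientForm
  AdelicGroupData.isFiniteMeasureQuotientForm

/-- **The geometric side for the anisotropic `U(H)`, class by class, with the printed covolumes, for the test function itself** (Rogawski
(1990), §14.5 pp. 237–238: `J_{G′}(f′) = Σ_γ a_γ Φ(γ, f′)`, `a_γ = m(G′_γ \ G′_γ(𝔸))` for the anisotropic inner form `G′`; Gelbart (1975), Remark 9.23):
for a CM field `L` and `H ∈ M_N(L)` ANISOTROPIC (compact quotient by Godement, ★ `compactSpace_cmDatum_automorphicQuotient`; `A_G = ⊥`, `U(H)(L⁺)` discrete: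
★ `cmDatum_center'`, `cmDatum_isDiscreteRational`), with `μ, ν, ρ, ν_c, ρ_{H,c}, ρ_{F,c}` as in §1 and `Φ ∈ C_c(U(H)(𝔸_{L⁺}), ℂ)`:
  `∫_X Σ'_{γ ∈ U(H)(L⁺)} Φ(x̃ γ x̃⁻¹) dμ(x) = Σ'_c (c_μ · vol(U(H)(𝔸)_{γ_c} ⧸ U(H)(L⁺)_{γ_c})) · ∫ Φ(y γ_c y⁻¹) d(ν ∕ ν_c)(y)`
with integrability and absolute convergence. [cite: Rogawski1990, §14.5 pp. 237–238] [cite: Gelbart1975, Remark 9.23] -/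
theorem integral_conjTsum_eq_tsum_covol_mul_cmDatum
    (hanis : ∀ x : Fin N → L, hermForm (cmConjRingHom L) H x x = 0 → x = 0)
    [hH : IsClosed ((cmDatum L N H).quotientSubgroup : Set (cmDatum L N H).Adelic)]
    [hCcl : ∀ γ : (cmDatum L N H).Adelic, IsClosed ((Subgroup.centralizer ({γ} : Set (cmDatum L N H).Adelic) :
      Subgroup (cmDatum L N H).Adelic) : Set (cmDatum L N H).Adelic)]
    (μ : Measure (cmDatum L N H).automorphicQuotient) [(cmDatum L N H).IsAutomorphicMeasure μ]
    (ν : Measure (cmDatum L N H).Adelic) [IsHaarMeasure ν] [ν.IsMulRightInvariant]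
    (ρ : Measure (cmDatum L N H).quotientSubgroup) [ρ.IsHaarMeasure] [SFinite ρ]
    (ρH : ∀ c : ConjClasses (cmDatum L N H).arithmeticSubgroup, Measure ↥((cmDatum L N H).quotientSubgroup ⊓
      Subgroup.centralizer ({((Quotient.out c : (cmDatum L N H).arithmeticSubgroup) : (cmDatum L N H).Adelic)} : Set (cmDatum L N H).Adelic)))
    [∀ c, IsHaarMeasure (ρH c)] [∀ c, (ρH c).IsInvInvariant] [∀ c, SFinite (ρH c)]
    (ρF : ∀ c : ConjClasses (cmDatum L N H).arithmeticSubgroup, Measure ↥(((cmDatum L N H).quotientSubgroup ⊓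
      Subgroup.centralizer ({((Quotient.out c : (cmDatum L N H).arithmeticSubgroup) : (cmDatum L N H).Adelic)} :
        Set (cmDatum L N H).Adelic)).subgroupOf (Subgroup.centralizer
          ({((Quotient.out c : (cmDatum L N H).arithmeticSubgroup) : (cmDatum L N H).Adelic)} : Set (cmDatum L N H).Adelic))))
    [∀ c, IsHaarMeasure (ρF c)] [∀ c, (ρF c).IsInvInvariant] [∀ c, SFinite (ρF c)]
    (νC : ∀ c : ConjClasses (cmDatum L N H).arithmeticSubgroup, Measure ↥(Subgroup.centralizer
      ({((Quotient.out c : (cmDatum L N H).arithmeticSubgroup) : (cmDatum L N H).Adelic)} : Set (cmDatum L N H).Adelic)))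
    [∀ c, IsHaarMeasure (νC c)] [∀ c, (νC c).IsMulRightInvariant] [∀ c, (νC c).IsInvInvariant] [∀ c, SFinite (νC c)]
    (hρH : ∀ c, ρH c = ρ.comap (Subgroup.inclusion inf_le_left))
    (hρF : ∀ c, ρF c = Measure.map (Subgroup.subgroupOfEquivOfLe inf_le_right).symm (ρH c))
    (Φ : C_c((cmDatum L N H).Adelic, ℂ)) :
    Integrable (conjTsum (cmDatum L N H).quotientSubgroup ((cmDatum L N H).arithmeticSubgroup : Set (cmDatum L N H).Adelic)
      (AdelicGroupData.conj_mem_arithmeticSubgroup (cmDatum L N H)) (⇑Φ)) μ ∧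
    (∀ c : ConjClasses (cmDatum L N H).arithmeticSubgroup, Integrable (descConj ((Quotient.out c : (cmDatum L N H).arithmeticSubgroup) : (cmDatum L N H).Adelic)
        (Subgroup.centralizer ({((Quotient.out c : (cmDatum L N H).arithmeticSubgroup) : (cmDatum L N H).Adelic)} : Set (cmDatum L N H).Adelic))
        (fun _ hg => Subgroup.mem_centralizer_singleton_iff.1 hg) (⇑Φ)) (quotientMeasure (Subgroup.centralizer
          ({((Quotient.out c : (cmDatum L N H).arithmeticSubgroup) : (cmDatum L N H).Adelic)} : Set (cmDatum L N H).Adelic)) (νC c) (hCcl _) ν)) ∧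
    Summable (fun c : ConjClasses (cmDatum L N H).arithmeticSubgroup => (unfoldingConstant (cmDatum L N H).quotientSubgroup ρ μ ν *
        quotientMeasure (((cmDatum L N H).quotientSubgroup ⊓ Subgroup.centralizer
          ({((Quotient.out c : (cmDatum L N H).arithmeticSubgroup) : (cmDatum L N H).Adelic)} : Set (cmDatum L N H).Adelic)).subgroupOf
          (Subgroup.centralizer ({((Quotient.out c : (cmDatum L N H).arithmeticSubgroup) : (cmDatum L N H).Adelic)} : Set (cmDatum L N H).Adelic)))
          (ρF c) (isClosed_subgroupOf _ _ (hH.inter (hCcl _))) (νC c) Set.univ).toReal *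
      ∫ y, ‖descConj ((Quotient.out c : (cmDatum L N H).arithmeticSubgroup) : (cmDatum L N H).Adelic)
        (Subgroup.centralizer ({((Quotient.out c : (cmDatum L N H).arithmeticSubgroup) : (cmDatum L N H).Adelic)} : Set (cmDatum L N H).Adelic))
        (fun _ hg => Subgroup.mem_centralizer_singleton_iff.1 hg) (⇑Φ) y‖ ∂(quotientMeasure (Subgroup.centralizer
            ({((Quotient.out c : (cmDatum L N H).arithmeticSubgroup) : (cmDatum L N H).Adelic)} : Set (cmDatum L N H).Adelic)) (νC c) (hCcl _) ν)) ∧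
    ∫ x, conjTsum (cmDatum L N H).quotientSubgroup ((cmDatum L N H).arithmeticSubgroup : Set (cmDatum L N H).Adelic)
        (AdelicGroupData.conj_mem_arithmeticSubgroup (cmDatum L N H)) (⇑Φ) x ∂μ = ∑' c : ConjClasses (cmDatum L N H).arithmeticSubgroup,
        (((unfoldingConstant (cmDatum L N H).quotientSubgroup ρ μ ν * quotientMeasure (((cmDatum L N H).quotientSubgroup ⊓ Subgroup.centralizer
            ({((Quotient.out c : (cmDatum L N H).arithmeticSubgroup) : (cmDatum L N H).Adelic)} : Set (cmDatum L N H).Adelic)).subgroupOf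
            (Subgroup.centralizer ({((Quotient.out c : (cmDatum L N H).arithmeticSubgroup) : (cmDatum L N H).Adelic)} : Set (cmDatum L N H).Adelic)))
            (ρF c) (isClosed_subgroupOf _ _ (hH.inter (hCcl _))) (νC c) Set.univ).toReal : ℝ) : ℂ) *
        ∫ y, descConj ((Quotient.out c : (cmDatum L N H).arithmeticSubgroup) : (cmDatum L N H).Adelic)
          (Subgroup.centralizer ({((Quotient.out c : (cmDatum L N H).arithmeticSubgroup) : (cmDatum L N H).Adelic)} : Set (cmDatum L N H).Adelic))
          (fun _ hg => Subgroup.mem_centralizer_singleton_iff.1 hg) (⇑Φ) y ∂(quotientMeasure (Subgroup.centralizer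
              ({((Quotient.out c : (cmDatum L N H).arithmeticSubgroup) : (cmDatum L N H).Adelic)} : Set (cmDatum L N H).Adelic)) (νC c) (hCcl _) ν) := by
  haveI := compactSpace_cmDatum_automorphicQuotient L N H hanis
  exact integral_conjTsum_eq_tsum_covol_mul_of_center'_eq_bot (cmDatum L N H) (cmDatum_center' L N H)
    (cmDatum_isDiscreteRational L N H) μ ν ρ ρH ρF νC hρH hρF Φ

end Unitary

end Summit.HodgeConjecture.HodgeConjecture.Cruxes.H413.K2E1KernelDiagonalOrbitalUnfolding

end
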